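import Summits.QuantumFields.YangMills.Theorems.BalabanUVNodesN14KingScalesDressing
import Literature.MathematicalPhysics.QuantumFieldTheory.Balaban1983to89.B16DressedTermBackground

/-!
# BalabanUVNodes ∕ node N14 = NE1′ — THE COUPLED KING-SCALES DRESSED TOWER: the born dressed term as a FUNCTION OF THE NEXT BACKGROUND
# (n14-c's first-order background model of [Balaban1989LargeFieldII] (1.73)–(1.75)), booked on King's block hierarchy along an ARBITRARY
# BACKGROUND PATH, with GENUINE GENERATIONS (births-from-old = re-expansions around the next background) — ROOT-C OF RECORD at `Λ = L^{dS}`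
# under the letter `L^{dS}·θ < 1`, constants chosen BEFORE the path; a MODEL RUNG, count-neutral

Cell `pub-ymgap`, HUMAN RULING D-0149 (director-ym №197), width seat `pub-ymgap-dag-n14-w3` g0, INTENT-2 (the COUPLED half of plan g77∕g78
`W-SEAT-START-LIST.md` v4 §2 «n14 NE1′» ITEM 3 «`DressedStabilityStrict` at the KING MODEL scales as the rung»); key K3⁷ = stmt-QuantumFields-20544
(`--supports … --as helper`); venue R424 (namespace `YMDAG.N14.KingScalesCoupled`).  ADDITIVE — imports this seat's `Thm/BalabanUVNodesN14KingScalesDressing`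
(p584037: `Pos`, `Under`, `card_filter_under_le` — King's L-adic block hierarchy and its counts; through it n14-c's `…N14DecoupledDressing`:
`Window`, `twoPointMeasure`, `twoPointW`, `integral_twoPoint`) and n14-c's `Lit/…/B16DressedTermBackground` (p462867: `dressLogAt`,
**`norm_dressLogAt_sub_le`** — whose header names THIS consumer: «the estimate a COUPLED dressed tower's transport leaf consumes») ONLY; modifies nothing.

WHY.  Every N14 model tower in the tree (n14-c's scale-decoupled tower, this seat's King-scales tower, n14-w1's top-born tower, n14-w2's guard
inhabitants) books born terms that depend on NOTHING downstream — one generation per family, the inter-scale content of NE1′ (re-expansion around the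
next background: transport leaf T ∕ (w4) ∕ (I4′), regeneration (w5), births-from-old (w1)+(w5b) of `DressedRoot.BookingLeaves`) discharged VACUOUSLY, said
in each file.  n14-c's `B16DressedTermBackground` typed the first COUPLING estimate in [B16]'s currency (background entering the exponent linearly,
`σ_u = σ + u·A`, `‖A‖ ≤ α`, `|u| ≤ r`): the born term `D_t(u) = dressLogAt μ ρ₀ σ A W u t` is LIPSCHITZ in `u`, first order in the oscillation.  THIS
FILE books that object on King's scales: run parameter = a source in the window AND a BACKGROUND PATH `u : ℕ → disc r`; the term born at `(j, y)` is
booked at scale `k` as `‖D⁽ᴷ⁻ʲ⁾_t(u_k) − t·c‖` (re-expanded around the CURRENT background), with the genuine generations `gen (j,y) j = ‖D_t(u_j) − t·c‖`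
(birth), `gen (j,y) k′ = ‖D_t(u_{k′}) − D_t(u_{k′−1})‖` (birth-from-old), `size ≤ Σ gen` by TELESCOPING (the triangle inequality, not `if k′ = j`).

WHAT IS PROVED (kernel, 0 sorry).  §1 `CoupledRun` [model data]; `bookedSize`, `genStep`, `ampC = C·e^{3(s+rα+l₀C)}·l₀`, `lipC = 2α·C·e^{6(…)}·l₀`;
**`bookedSize_le`** (`≤ ampC·θⁿ` at EVERY background in the disc — `norm_dressLog_sub_mul_le` at exponent `σ + u·A` BY NAME); **`genStep_le`** (`≤
lipC·θⁿ·‖u − u′‖` — `norm_dressLogAt_sub_le` BY NAME: THE REGENERATION LEAF, NON-VACUOUS); `bookedSize_le_sum_gen` (telescoping).  §2 `Path r`,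
`bookingC`∕`trajectoryC`∕`towerC : DressedTower (Window l₀ × Path r)`∕`carriersC` on `YMDAG.N14.KingScales.Pos L dS K`; `gen_birth_le`, `gen_step_le`.  §3
`positionalCount_towerC` (`Λ = L^{dS}`, `card_filter_under_le` BY NAME), `classAt_towerC` (class `twoRate ampC 1 θ K`, ONE triple BEFORE source, path, cutoff),
**`dressedStabilityStrict_towerC : (L^{dS})·θ < 1 → DressedStabilityStrict (towerC L dS R) (L^{dS})`**, `n14At_towerC`, `dressedBudget_towerC`.  §4 NON-IDLE
COUPLING [decided toy]: `twoPointCoupled` (fibres `δ_true + δ_false`, `W_n = ±½(½)ⁿ`, SENSITIVITY `A = ±1` correlated with the observable, `s = 0`, `B = C = θ = ½`,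
`α = 1`, `r = ¼`, `l₀ = ½`, every proviso in kernel); `dressLogAt_twoPointCoupled` (`D_y(x) = log 2cosh(x + y∕2) − log 2cosh x`);
**`genStep_twoPointCoupled_pos`** (depth `0`, `t = ½`, `u = ¼`, `u′ = 0`: the birth-from-old is `> 0` since `cosh ½ = cosh²¼ + sinh²¼ > cosh²¼`).

HONEST FRAMING (A6 ∕ №189).  A MODEL RUNG over hypothesis SHAPES + a decided toy — NOT a discharge claim.  `ρ₁ = 1` here is the model's TRUTH, not a
vacuity: on a bounded background disc a born term coupled to the background at FIRST ORDER never grows geometrically under re-expansion; what the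
coupled tower adds over the decoupled one is (i) uniformity over ALL background paths (the (w4)-type quantifier order) and (ii) genuine generations
whose sizes are the [B16] background-Lipschitz estimate.  The linear background model is n14-c's, NOT Bałaban's `σ(U)`; nothing of Bałaban's densities and
none of King's operators is instantiated; NE1′ is NOT PRINTED ([Balaban1989LargeFieldII] p. 356 ll. 1–6 defers observables) and NOT PROVED; N14 NOT
discharged (DEPENDENT on §N19 s1 ∕ U3, director-ym №195 (8); K3⁷ v2 pins `ne1 :=` n14-w1's top-born tower — plan g78); count-neutral (typed 28∕28,
discharged 5∕27 — UNMOVED).  One finite four-torus programme at fixed ε; R4 closes only the conditional finite-𝕋⁴ rung `BalabanLadder.UV` — NOT ℝ⁴, NOT OS,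
NOT a mass gap, NOT Clay.  [folklore] kernel mathematics over the cited modules; 0 sorry; standard axioms.

Sources: [Balaban1989LargeFieldII] CMP 122 (1989) (1.73)–(1.75) pp. 379–380 (via the imports); [King1986] CMP 102 (1986) (2.10) p. 653 (ref-N READ-2 NIT on p584037: p. 653, not 652).  No mass-gap claim.
-/

noncomputable section

namespace YMDAG.N14.KingScalesCoupled

open MeasureTheory Finset Literature.MathematicalPhysics.QuantumFieldTheory.Balaban1983to89
open scoped BigOperators
open Literature.MathematicalPhysics.QuantumFieldTheory.Balaban1983to89.T4TermFormat T4TermFormat.Booking T4TrajectoryComparison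
open Literature.MathematicalPhysics.QuantumFieldTheory.Balaban1983to89.B16Ineq175Tilted (tiltWeight_apply)
open Literature.MathematicalPhysics.QuantumFieldTheory.Balaban1983to89.B16DressedActionTerm
open Literature.MathematicalPhysics.QuantumFieldTheory.Balaban1983to89.B16DressedTermBackground
open Summit.QuantumFields.BalabanUV.T4Continuum.NE1p.DressedRoot
open YMDAG.UVSplit (NE1pCarriers N14At)
open YMDAG.N14.Decoupled (Window twoPointMeasure twoPointW norm_twoPointW integral_twoPoint)
open YMDAG.N14.KingScales (Pos Under card_filter_under_le)

/-! ## §1 The coupled run: a born term that is a function of the next background, and its two [B16] estimates -/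

/-- **DATA — A FIRST-ORDER-COUPLED DRESSED RUN** [model data]: n14-c's `DecoupledRun` provisos per depth `n` (measure, positive density, small exponent
`‖σ_n‖ ≤ s`, fibre piece `‖W_n‖ ≤ B` with oscillation `‖W_n − c_n‖ ≤ C·θⁿ`) PLUS the SENSITIVITY `A_n` of the step's exponent to the next background
(`‖A_n‖ ≤ α`; the exponent at background parameter `u` is `σ_n + u·A_n`, `|u| ≤ r` — n14-c's `B16DressedTermBackground` model), on the JOINT tilt discs
`s + r·α + l₀·B ≤ 1`, `s + r·α + l₀·C ≤ 1`.  Nothing of Bałaban's densities is asserted. -/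
structure CoupledRun (Z : Type) [MeasurableSpace Z] where
  /-- fibre measure, density, small exponent, sensitivity, fibre piece of the observable, its field-independent part — per depth -/
  μ : ℕ → Measure Z
  ρ₀ : ℕ → Z → ℝ
  σ : ℕ → Z → ℂ
  A : ℕ → Z → ℂ
  W : ℕ → Z → ℂ
  c : ℕ → ℂ
  /-- letters: exponent margin, observable bound, oscillation constant and rate, source radius, sensitivity bound, background radius -/
  (s B C θ l₀ α r : ℝ)
  hρ : ∀ n, Integrable (ρ₀ n) (μ n)
  hρ0 : ∀ n, 0 ≤ᵐ[μ n] ρ₀ n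
  hP : ∀ n, 0 < ∫ z, ρ₀ n z ∂μ n
  hσm : ∀ n, AEStronglyMeasurable (σ n) (μ n)
  hAm : ∀ n, AEStronglyMeasurable (A n) (μ n)
  hWm : ∀ n, AEStronglyMeasurable (W n) (μ n)
  hσ : ∀ n, ∀ᵐ z ∂μ n, ‖σ n z‖ ≤ s
  hA : ∀ n, ∀ᵐ z ∂μ n, ‖A n z‖ ≤ α
  hW : ∀ n, ∀ᵐ z ∂μ n, ‖W n z‖ ≤ B
  hosc : ∀ n, ∀ᵐ z ∂μ n, ‖W n z - c n‖ ≤ C * θ ^ n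
  hC : 0 ≤ C
  hθ0 : 0 ≤ θ
  hθ1 : θ < 1
  hl₀ : 0 ≤ l₀
  hα : 0 ≤ α
  hr : 0 ≤ r
  hdiscB : s + r * α + l₀ * B ≤ 1
  hdiscC : s + r * α + l₀ * C ≤ 1

variable {Z : Type} [MeasurableSpace Z]

/-- **THE BOOKED SIZE AT BACKGROUND `u`** [model]: `‖D⁽ⁿ⁾_t(u) − t·c_n‖` — the depth-`n` born term re-expanded around the background parameter `u`,
past its field-independent linear part. -/
def bookedSize (R : CoupledRun Z) (n : ℕ) (u t : ℂ) : ℝ :=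
  ‖dressLogAt (R.μ n) (R.ρ₀ n) (R.σ n) (R.A n) (R.W n) u t - t * R.c n‖

/-- **THE BIRTH-FROM-OLD BETWEEN TWO BACKGROUNDS** [model]: `‖D⁽ⁿ⁾_t(u) − D⁽ⁿ⁾_t(u′)‖` — what the re-expansion around the next background books. -/
def genStep (R : CoupledRun Z) (n : ℕ) (u u' t : ℂ) : ℝ :=
  ‖dressLogAt (R.μ n) (R.ρ₀ n) (R.σ n) (R.A n) (R.W n) u t - dressLogAt (R.μ n) (R.ρ₀ n) (R.σ n) (R.A n) (R.W n) u' t‖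

/-- The class amplitude `C·e^{3(s+rα+l₀C)}·l₀` [model] — K-, source- and PATH-free. -/
def ampC (R : CoupledRun Z) : ℝ := R.C * Real.exp (3 * (R.s + R.r * R.α + R.l₀ * R.C)) * R.l₀
/-- The regeneration Lipschitz constant `2α·C·e^{6(s+rα+l₀C)}·l₀` [model]. -/
def lipC (R : CoupledRun Z) : ℝ := 2 * R.α * R.C * Real.exp (6 * (R.s + R.r * R.α + R.l₀ * R.C)) * R.l₀

/-- The class amplitude is nonnegative. [folklore] -/
theorem ampC_nonneg (R : CoupledRun Z) : 0 ≤ ampC R := by unfold ampC; exact mul_nonneg (mul_nonneg R.hC (Real.exp_pos _).le) R.hl₀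

/-- The observable's bound is nonnegative (depth-`0` data witness it since the base mass is positive). [folklore] -/
theorem B_nonneg (R : CoupledRun Z) : 0 ≤ R.B := by
  have hμ : R.μ 0 ≠ 0 := by
    intro h0; have := R.hP 0; rw [h0, integral_zero_measure] at this; exact lt_irrefl _ this
  haveI : (ae (R.μ 0)).NeBot := ae_neBot.mpr hμ
  obtain ⟨z, hz⟩ := (R.hW 0).exists
  exact (norm_nonneg _).trans hz

/-- The exponent at a background in the disc stays small: `‖σ_n + u·A_n‖ ≤ s + r·α` a.e. [folklore] -/
theorem exponent_le (R : CoupledRun Z) (n : ℕ) {u : ℂ} (hu : ‖u‖ ≤ R.r) :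
    ∀ᵐ z ∂(R.μ n), ‖R.σ n z + u * R.A n z‖ ≤ R.s + R.r * R.α := by
  filter_upwards [R.hσ n, R.hA n] with z h1 h2
  calc ‖R.σ n z + u * R.A n z‖ ≤ ‖R.σ n z‖ + ‖u‖ * ‖R.A n z‖ := (norm_add_le _ _).trans (by rw [norm_mul])
    _ ≤ R.s + R.r * R.α := add_le_add h1 (mul_le_mul hu h2 (norm_nonneg _) R.hr)

/-- The two tilt discs at a source in the window and oscillation `C·θⁿ ≤ C`. [arith] -/
theorem discs (R : CoupledRun Z) (n : ℕ) {t : ℂ} (ht : ‖t‖ ≤ R.l₀) :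
    R.s + R.r * R.α + ‖t‖ * R.B ≤ 1 ∧ ‖t‖ * (R.C * R.θ ^ n) ≤ R.l₀ * R.C ∧ R.s + R.r * R.α + ‖t‖ * (R.C * R.θ ^ n) ≤ 1 := by
  have hCθ : R.C * R.θ ^ n ≤ R.C := by simpa using mul_le_mul_of_nonneg_left (pow_le_one₀ R.hθ0 R.hθ1.le) R.hC
  have h1 := mul_le_mul_of_nonneg_right ht (B_nonneg R)
  have htC' : ‖t‖ * (R.C * R.θ ^ n) ≤ R.l₀ * R.C := mul_le_mul ht hCθ (mul_nonneg R.hC (pow_nonneg R.hθ0 n)) R.hl₀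
  exact ⟨by linarith [R.hdiscB], htC', by linarith [R.hdiscC]⟩

/-- **THE BIRTH ESTIMATE AT EVERY BACKGROUND IN THE DISC** [the (1.75)ₜ dressing estimate BY NAME]: for `|u| ≤ r` and `‖t‖ ≤ l₀`,
`‖D⁽ⁿ⁾_t(u) − t·c_n‖ ≤ ampC·θⁿ` — n14-c's `norm_dressLog_sub_mul_le` at the exponent `σ_n + u·A_n` (margin `s + rα`), oscillation `B₀ = C·θⁿ`. -/
theorem bookedSize_le (R : CoupledRun Z) (n : ℕ) {u t : ℂ} (hu : ‖u‖ ≤ R.r) (ht : ‖t‖ ≤ R.l₀) : bookedSize R n u t ≤ ampC R * R.θ ^ n := by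
  have hθn : 0 ≤ R.θ ^ n := pow_nonneg R.hθ0 n
  obtain ⟨htB, htC', htC⟩ := discs R n ht
  have key := norm_dressLog_sub_mul_le (R.hρ n) (R.hρ0 n) (R.hP n) ((R.hσm n).add (aestronglyMeasurable_const.mul (R.hAm n)))
    (R.hWm n) (exponent_le R n hu) (R.hW n) (R.hosc n) htB htC
  unfold bookedSize dressLogAt ampC
  refine key.trans ?_
  have hexp : Real.exp (3 * (R.s + R.r * R.α + ‖t‖ * (R.C * R.θ ^ n))) ≤ Real.exp (3 * (R.s + R.r * R.α + R.l₀ * R.C)) :=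
    Real.exp_le_exp.mpr (by linarith)
  calc R.C * R.θ ^ n * Real.exp (3 * (R.s + R.r * R.α + ‖t‖ * (R.C * R.θ ^ n))) * ‖t‖
      ≤ R.C * R.θ ^ n * Real.exp (3 * (R.s + R.r * R.α + R.l₀ * R.C)) * R.l₀ :=
        mul_le_mul (mul_le_mul_of_nonneg_left hexp (mul_nonneg R.hC hθn)) ht (norm_nonneg _)
          (mul_nonneg (mul_nonneg R.hC hθn) (Real.exp_pos _).le)
    _ = R.C * Real.exp (3 * (R.s + R.r * R.α + R.l₀ * R.C)) * R.l₀ * R.θ ^ n := by ring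

/-- **THE REGENERATION LEAF, NON-VACUOUS** [the coupling estimate BY NAME]: for backgrounds `|u|, |u′| ≤ r` and `‖t‖ ≤ l₀`,
`‖D⁽ⁿ⁾_t(u) − D⁽ⁿ⁾_t(u′)‖ ≤ lipC·θⁿ·‖u − u′‖` — n14-c's `norm_dressLogAt_sub_le` with oscillation `B₀ = C·θⁿ`: the birth-from-old that the re-expansion
around the next background books is first order in the source, GEOMETRIC IN THE AGE OF THE BIRTH, and Lipschitz in the background increment. -/
theorem genStep_le (R : CoupledRun Z) (n : ℕ) {u u' t : ℂ} (hu : ‖u‖ ≤ R.r) (hu' : ‖u'‖ ≤ R.r) (ht : ‖t‖ ≤ R.l₀) :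
    genStep R n u u' t ≤ lipC R * R.θ ^ n * ‖u - u'‖ := by
  have hθn : 0 ≤ R.θ ^ n := pow_nonneg R.hθ0 n
  obtain ⟨htB, htC', htC⟩ := discs R n ht
  have key := norm_dressLogAt_sub_le (R.hρ n) (R.hρ0 n) (R.hP n) (R.hσm n) (R.hWm n) (R.hAm n) (R.hσ n) (R.hW n) (R.hosc n)
    (R.hA n) htB htC hu hu'
  unfold genStep lipC
  refine key.trans ?_
  have hexp : Real.exp (6 * (R.s + R.r * R.α + ‖t‖ * (R.C * R.θ ^ n))) ≤ Real.exp (6 * (R.s + R.r * R.α + R.l₀ * R.C)) :=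
    Real.exp_le_exp.mpr (by linarith)
  have h0 : 0 ≤ 2 * R.α * (R.C * R.θ ^ n) := mul_nonneg (mul_nonneg zero_le_two R.hα) (mul_nonneg R.hC hθn)
  calc 2 * R.α * (R.C * R.θ ^ n) * Real.exp (6 * (R.s + R.r * R.α + ‖t‖ * (R.C * R.θ ^ n))) * ‖t‖ * ‖u - u'‖
      ≤ 2 * R.α * (R.C * R.θ ^ n) * Real.exp (6 * (R.s + R.r * R.α + R.l₀ * R.C)) * R.l₀ * ‖u - u'‖ := by
        apply mul_le_mul_of_nonneg_right _ (norm_nonneg _)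
        exact mul_le_mul (mul_le_mul_of_nonneg_left hexp h0) ht (norm_nonneg _) (mul_nonneg h0 (Real.exp_pos _).le)
    _ = 2 * R.α * R.C * Real.exp (6 * (R.s + R.r * R.α + R.l₀ * R.C)) * R.l₀ * R.θ ^ n * ‖u - u'‖ := by ring

/-- **TELESCOPING** [bookkeeping]: along any background path the booked size at scale `k ≥ j` is at most the birth at `u_j` plus the births-from-old
`‖D(u_{k′}) − D(u_{k′−1})‖`, `j < k′ ≤ k` — the `Trajectory.size_le` convention by the triangle inequality. -/
theorem bookedSize_le_sum_gen (R : CoupledRun Z) (n : ℕ) (u : ℕ → ℂ) (t : ℂ) {j k : ℕ} (hjk : j ≤ k) :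
    bookedSize R n (u k) t ≤
      ∑ k' ∈ Icc j k, (if k' = j then bookedSize R n (u j) t else genStep R n (u k') (u (k' - 1)) t) := by
  induction k, hjk using Nat.le_induction with
  | base => rw [Finset.Icc_self, Finset.sum_singleton, if_pos rfl]
  | succ k hk ih =>
    rw [Finset.sum_Icc_succ_top (Nat.le_succ_of_le hk), if_neg (by omega), Nat.add_sub_cancel]
    have htri : bookedSize R n (u (k + 1)) t ≤ genStep R n (u (k + 1)) (u k) t + bookedSize R n (u k) t := by
      unfold bookedSize genStep
      exact norm_sub_le_norm_sub_add_norm_sub _ _ _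
    linarith

/-! ## §2 The coupled tower on King's block hierarchy: source window × background path, genuine generations -/

/-- **A BACKGROUND PATH IN THE DISC** [model data]: the run's background parameter scale by scale, `‖u k‖ ≤ r` ((w4)-type window). -/
def Path (r : ℝ) : Type := {u : ℕ → ℂ // ∀ k, ‖u k‖ ≤ r}

open Classical in
/-- **THE COUPLED BOOKING** at source `t`, path `u`, cutoff `K` [model]: births = cubes = `Pos L dS K` (this seat's King-scales hierarchy), `b` felt at `q` iff
`Under L b q`; the birth `(j, y)` is booked at scale `k` as `‖D⁽ᴷ⁻ʲ⁾_t(u_k) − t·c‖` — RE-EXPANDED AROUND THE CURRENT BACKGROUND `u_k`. -/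
def bookingC (L dS : ℕ) (R : CoupledRun Z) (t : ℂ) (u : ℕ → ℂ) (K : ℕ) : T4TermFormat.Booking where
  K := K
  Dom := Pos L dS K
  domScale := fun X => X.1.val
  treeLen := fun _ => 0
  treeLen_nonneg := fun _ => le_rfl
  balSize := fun _ => 0
  Birth := Pos L dS K
  births := Finset.univ
  mem_births := fun b => Finset.mem_univ b
  birthScale := fun b => b.1.val
  birth_le := fun b => Nat.lt_succ_iff.mp b.1.isLt
  loc := fun b => b
  loc_scale := fun _ => rfl
  Cube := Pos L dS K
  cubes := Finset.univ
  mem_cubes := fun q => Finset.mem_univ q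
  cubeScale := fun q => q.1.val
  cube_le := fun q => Nat.lt_succ_iff.mp q.1.isLt
  feltAt := fun q => Finset.univ.filter fun b => Under L b q
  felt_birth_le := fun _ _ hb => (Finset.mem_filter.mp hb).2.1
  size := fun b k => bookedSize R (K - b.1.val) (u k) t
  size_nonneg := fun _ _ => norm_nonneg _
  pair := fun _ _ _ => 0

/-- **ITS TRAJECTORY WITH GENUINE GENERATIONS** [model]: generation `j` = the birth at `u_j`; generation `k′ ≠ j` = the birth-from-old
`‖D(u_{k′}) − D(u_{k′−1})‖`; re-linearised sizes constant after generation; `size ≤ Σ gen` by `bookedSize_le_sum_gen`. -/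
def trajectoryC (L dS : ℕ) (R : CoupledRun Z) (t : ℂ) (u : ℕ → ℂ) (K : ℕ) : Trajectory (bookingC L dS R t u K) where
  gen := fun b k' => if k' = b.1.val then bookedSize R (K - b.1.val) (u b.1.val) t else genStep R (K - b.1.val) (u k') (u (k' - 1)) t
  gen_nonneg := fun b k' => by split_ifs <;> exact norm_nonneg _
  lin := fun b k' _ => if k' = b.1.val then bookedSize R (K - b.1.val) (u b.1.val) t else genStep R (K - b.1.val) (u k') (u (k' - 1)) t
  lin_nonneg := fun b k' _ => by split_ifs <;> exact norm_nonneg _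
  size_le := fun b k hjk _ => bookedSize_le_sum_gen R (K - b.1.val) u t hjk

/-- **THE COUPLED KING-SCALES DRESSED TOWER** [model]: run parameter = (source in the window `‖t‖ ≤ l₀`, background path in the disc `r`). -/
def towerC (L dS : ℕ) (R : CoupledRun Z) : DressedTower (Window R.l₀ × Path R.r) where
  B := fun p K => bookingC L dS R p.1.val p.2.val K
  K_eq := fun _ _ => rfl
  T := fun p K => trajectoryC L dS R p.1.val p.2.val K

/-- Its carriers in the route's vocabulary at the block positional rate `Λ = L^{dS}`. [model] -/
def carriersC (L dS : ℕ) (R : CoupledRun Z) : NE1pCarriers := ⟨Window R.l₀ × Path R.r, towerC L dS R, (L : ℝ) ^ dS⟩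

/-- **EVERY BIRTH GENERATION OBEYS THE BIRTH ESTIMATE** [§1 BY NAME]. -/
theorem gen_birth_le (L dS : ℕ) (R : CoupledRun Z) (p : Window R.l₀ × Path R.r) (K : ℕ) (b : Pos L dS K) :
    ((towerC L dS R).T p K).gen b b.1.val ≤ ampC R * R.θ ^ (K - b.1.val) := by
  show (if b.1.val = b.1.val then bookedSize R (K - b.1.val) (p.2.val b.1.val) p.1.val
    else genStep R (K - b.1.val) (p.2.val b.1.val) (p.2.val (b.1.val - 1)) p.1.val) ≤ _
  rw [if_pos rfl]
  exact bookedSize_le R _ (p.2.property _) p.1.property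

/-- **EVERY BIRTH-FROM-OLD OBEYS THE REGENERATION ESTIMATE** [§1 BY NAME]: generation `k′ ≠ j` is `≤ lipC·θ^{K−j}·‖u_{k′} − u_{k′−1}‖`. -/
theorem gen_step_le (L dS : ℕ) (R : CoupledRun Z) (p : Window R.l₀ × Path R.r) (K : ℕ) (b : Pos L dS K) {k' : ℕ} (hk : k' ≠ b.1.val) :
    ((towerC L dS R).T p K).gen b k' ≤ lipC R * R.θ ^ (K - b.1.val) * ‖p.2.val k' - p.2.val (k' - 1)‖ := by
  show (if k' = b.1.val then bookedSize R (K - b.1.val) (p.2.val b.1.val) p.1.val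
    else genStep R (K - b.1.val) (p.2.val k') (p.2.val (k' - 1)) p.1.val) ≤ _
  rw [if_neg hk]
  exact genStep_le R _ (p.2.property _) (p.2.property _) p.1.property

/-! ## §3 ROOT-C OF RECORD on the coupled tower: counts, class, strict root, node statement, ROOT-B -/

/-- **POSITIONAL COUNT** [this seat's `card_filter_under_le` BY NAME]: `N₀ = 1`, `Λ = L^{dS}`. -/
theorem positionalCount_towerC {L : ℕ} (hL : 1 ≤ L) (dS : ℕ) (R : CoupledRun Z) (p : Window R.l₀ × Path R.r) (K : ℕ) :
    ((towerC L dS R).B p K).PositionalCount fun j k => 1 * ((L : ℝ) ^ dS) ^ (k - j) := by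
  classical
  intro q j
  show ((_ : ℕ) : ℝ) ≤ 1 * ((L : ℝ) ^ dS) ^ (q.1.val - j)
  rw [one_mul]
  refine card_filter_under_le hL _ q j fun b hb => ?_
  obtain ⟨hb1, hb2⟩ := mem_feltOfScale.mp hb
  exact ⟨(Finset.mem_filter.mp hb1).2, hb2⟩

/-- **THE CLASS, UNIFORM OVER SOURCES, PATHS AND CUTOFFS** [§1 BY NAME]: every booking of the coupled tower lies in `twoRate ampC 1 θ K` — the term
born at `(j, y)` re-expanded around ANY background of the disc at ANY later scale is `≤ ampC·θ^{K−j}`. -/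
theorem classAt_towerC (L dS : ℕ) (R : CoupledRun Z) (p : Window R.l₀ × Path R.r) (K : ℕ) : ClassAt ((towerC L dS R).B p K) (ampC R) 1 R.θ := by
  intro b k _ _
  show bookedSize R (K - b.1.val) (p.2.val k) p.1.val ≤ twoRate (ampC R) 1 R.θ K b.1.val k
  rw [twoRate, one_pow, mul_one]
  exact bookedSize_le R _ (p.2.property k) p.1.property

/-- The root with constants displayed: ONE `(ampC, 1, θ)` before the source, the path and the cutoff. [bookkeeping] -/
theorem dressedStabilityWith_towerC (L dS : ℕ) (R : CoupledRun Z) : DressedStabilityWith (towerC L dS R) (ampC R) 1 R.θ :=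
  ⟨ampC_nonneg R, zero_le_one, R.hθ0, R.hθ1.le, fun p K => classAt_towerC L dS R p K⟩

/-- **THE DECL OF RECORD ON THE COUPLED KING-SCALES TOWER**: under the letter `L^{dS}·θ < 1`, `DressedStabilityStrict (towerC L dS R) (L^{dS})` with
`(A₀, ρ₁, τ, r) = (ampC, 1, θ, L^{dS}θ)` (owner's `dressedStabilityStrict_of_with` BY NAME).  NOT a discharge. -/
theorem dressedStabilityStrict_towerC (L dS : ℕ) (R : CoupledRun Z) (hprod : (L : ℝ) ^ dS * R.θ < 1) :
    DressedStabilityStrict (towerC L dS R) ((L : ℝ) ^ dS) :=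
  dressedStabilityStrict_of_with (r := (L : ℝ) ^ dS * R.θ) (dressedStabilityWith_towerC L dS R) (by positivity) (by rw [mul_one]) hprod

/-- The route's node statement at the coupled model carriers. [by name] -/
theorem n14At_towerC (L dS : ℕ) (R : CoupledRun Z) (hprod : (L : ℝ) ^ dS * R.θ < 1) : N14At (carriersC L dS R) :=
  dressedStabilityStrict_towerC L dS R hprod

/-- ROOT-B on the coupled tower (owner's `dressedBudget_of_dressedStabilityStrict` + the count). [bookkeeping] -/
theorem dressedBudget_towerC {L : ℕ} (hL : 1 ≤ L) (dS : ℕ) (R : CoupledRun Z) (hprod : (L : ℝ) ^ dS * R.θ < 1) {wbar : ℝ}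
    (hwbar : 0 ≤ wbar) (w : Window R.l₀ × Path R.r → ℕ → ℕ → ℝ) (hw0 : ∀ p K, ∀ j ≤ K, 0 ≤ w p K j)
    (hwb : ∀ p K, ∀ j ≤ K, w p K j ≤ wbar) : DressedBudget (towerC L dS R) w :=
  dressedBudget_of_dressedStabilityStrict (N₀ := 1) (dressedStabilityStrict_towerC L dS R hprod) zero_le_one hwbar hw0 hwb
    fun p K => positionalCount_towerC hL dS R p K

/-! ## §4 The coupling is not idle: two-point fibres with a sensitivity correlated to the observable -/

section TwoPoint
/-- The two-point sensitivity `A = ±1` (same sign as the fibre piece). [decided toy] -/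
def twoPointA (b : Bool) : ℂ := if b then 1 else -1

/-- `‖±1‖ = 1`. [folklore] -/
theorem norm_twoPointA (b : Bool) : ‖twoPointA b‖ = 1 := by unfold twoPointA; split_ifs <;> simp

/-- **THE TWO-POINT COUPLED RUN** [decided data]: fibres `δ_true + δ_false`, `ρ₀ ≡ 1`, `σ ≡ 0`, `W_n = ±½(½)ⁿ` (n14-c's `twoPointW`), sensitivity
`A ≡ ±1`, `c ≡ 0`, `s = 0`, `B = C = θ = ½`, `l₀ = ½`, `α = 1`, `r = ¼` — every proviso of `CoupledRun` checked in kernel (joint discs `¼ + ¼ ≤ 1`). -/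
def twoPointCoupled : CoupledRun Bool where
  μ := fun _ => twoPointMeasure
  ρ₀ := fun _ _ => 1
  σ := fun _ _ => 0
  A := fun _ => twoPointA
  W := twoPointW
  c := fun _ => 0
  s := 0
  B := 1 / 2
  C := 1 / 2
  θ := 1 / 2
  l₀ := 1 / 2
  α := 1
  r := 1 / 4
  hρ := fun _ => integrable_const _
  hρ0 := fun _ => ae_of_all _ fun _ => zero_le_one
  hP := fun _ => by rw [integral_twoPoint]; norm_num
  hσm := fun _ => aestronglyMeasurable_const
  hAm := fun _ => (measurable_of_finite twoPointA).aestronglyMeasurable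
  hWm := fun n => (measurable_of_finite (twoPointW n)).aestronglyMeasurable
  hσ := fun _ => ae_of_all _ fun _ => by simp
  hA := fun _ => ae_of_all _ fun b => (norm_twoPointA b).le
  hW := fun n => ae_of_all _ fun b => by
    rw [norm_twoPointW]; nlinarith [pow_le_one₀ (n := n) (by norm_num : (0:ℝ) ≤ 1 / 2) (by norm_num)]
  hosc := fun n => ae_of_all _ fun b => by rw [sub_zero, norm_twoPointW]
  hC := by norm_num
  hθ0 := by norm_num
  hθ1 := by norm_num
  hl₀ := by norm_num
  hα := zero_le_one
  hr := by norm_num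
  hdiscB := by norm_num
  hdiscC := by norm_num

/-- The tilted normalisation of the two-point coupled run at depth `0`, REAL background `x` and REAL source `y`: `2·cosh(x + y∕2)`. [folklore] -/
theorem tiltNorm_twoPointCoupled (x y : ℝ) :
    tiltNorm twoPointMeasure (fun _ => (1 : ℝ)) (fun b => (0 : ℂ) + (x : ℂ) * twoPointA b) (twoPointW 0) (y : ℂ) =
      ((2 * Real.cosh (x + y / 2) : ℝ) : ℂ) := by
  have e1 : (0 : ℂ) + (x : ℂ) * twoPointA true + (y : ℂ) * twoPointW 0 true = ((x + y / 2 : ℝ) : ℂ) := by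
    simp only [twoPointA, twoPointW, if_true, pow_zero, mul_one]; push_cast; ring
  have e2 : (0 : ℂ) + (x : ℂ) * twoPointA false + (y : ℂ) * twoPointW 0 false = ((-(x + y / 2) : ℝ) : ℂ) := by
    simp only [twoPointA, twoPointW, Bool.false_eq_true, if_false, pow_zero, mul_one]; push_cast; ring
  rw [tiltNorm_def, integral_twoPoint, tiltWeight_apply, tiltWeight_apply, e1, e2, Complex.ofReal_one, one_mul, one_mul,
    ← Complex.ofReal_exp, ← Complex.ofReal_exp, ← Complex.ofReal_add, Real.cosh_eq]
  push_cast
  ring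

/-- **THE BORN TERM OF THE TWO-POINT COUPLED RUN** at depth `0`, real background `x`, real source `y`: `D_y(x) = log(2cosh(x + y∕2)) − log(2cosh x)`. -/
theorem dressLogAt_twoPointCoupled (x y : ℝ) :
    dressLogAt twoPointMeasure (fun _ => (1 : ℝ)) (fun _ => (0 : ℂ)) twoPointA (twoPointW 0) (x : ℂ) (y : ℂ) =
      ((Real.log (2 * Real.cosh (x + y / 2)) - Real.log (2 * Real.cosh x) : ℝ) : ℂ) := by
  unfold dressLogAt dressLog
  have h1 := tiltNorm_twoPointCoupled x y
  have h0 := tiltNorm_twoPointCoupled x 0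
  rw [Complex.ofReal_zero] at h0
  rw [h1, h0, zero_div, add_zero, ← Complex.ofReal_log (by positivity), ← Complex.ofReal_log (by positivity), Complex.ofReal_sub]

/-- **THE COUPLING BOOKS SOMETHING** [decided toy]: at depth `0`, source `t = ½` (in the window `l₀ = ½`), backgrounds `u = ¼`, `u′ = 0` (in the disc
`r = ¼`) the birth-from-old of the two-point coupled run is POSITIVE — it equals `log(2cosh ½) + log 2 − 2·log(2cosh ¼) > 0` since
`cosh ½ = cosh²¼ + sinh²¼ > cosh²¼`. -/
theorem genStep_twoPointCoupled_pos : 0 < genStep twoPointCoupled 0 ((1 / 4 : ℝ) : ℂ) ((0 : ℝ) : ℂ) ((1 / 2 : ℝ) : ℂ) := by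
  have hD1 : dressLogAt twoPointMeasure (fun _ => (1 : ℝ)) (fun _ => (0 : ℂ)) twoPointA (twoPointW 0) ((1 / 4 : ℝ) : ℂ) ((1 / 2 : ℝ) : ℂ) =
      ((Real.log (2 * Real.cosh (1 / 2)) - Real.log (2 * Real.cosh (1 / 4)) : ℝ) : ℂ) := by
    rw [dressLogAt_twoPointCoupled]; norm_num
  have hD0 : dressLogAt twoPointMeasure (fun _ => (1 : ℝ)) (fun _ => (0 : ℂ)) twoPointA (twoPointW 0) ((0 : ℝ) : ℂ) ((1 / 2 : ℝ) : ℂ) =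
      ((Real.log (2 * Real.cosh (1 / 4)) - Real.log 2 : ℝ) : ℂ) := by
    rw [dressLogAt_twoPointCoupled]; norm_num
  unfold genStep
  show 0 < ‖dressLogAt twoPointMeasure (fun _ => (1 : ℝ)) (fun _ => (0 : ℂ)) twoPointA (twoPointW 0) ((1 / 4 : ℝ) : ℂ) ((1 / 2 : ℝ) : ℂ) -
    dressLogAt twoPointMeasure (fun _ => (1 : ℝ)) (fun _ => (0 : ℂ)) twoPointA (twoPointW 0) ((0 : ℝ) : ℂ) ((1 / 2 : ℝ) : ℂ)‖
  rw [hD1, hD0, ← Complex.ofReal_sub, Complex.norm_real, Real.norm_eq_abs]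
  refine abs_pos_of_pos ?_
  have ha : 0 < 2 * Real.cosh (1 / 2 : ℝ) := by positivity
  have key : (2 * Real.cosh (1 / 4)) ^ 2 < 2 * Real.cosh (1 / 2) * 2 := by
    have hc : Real.cosh (1 / 2 : ℝ) = Real.cosh (1 / 4) ^ 2 + Real.sinh (1 / 4) ^ 2 := by
      rw [← Real.cosh_two_mul]; norm_num
    have hs : 0 < Real.sinh (1 / 4 : ℝ) := Real.sinh_pos_iff.mpr (by norm_num)
    nlinarith
  have hlog := Real.log_lt_log (by positivity) key
  rw [Real.log_pow, Real.log_mul (x := 2 * Real.cosh (1 / 2)) (y := 2) ha.ne' two_ne_zero] at hlog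
  push_cast at hlog
  linarith

end TwoPoint
end YMDAG.N14.KingScalesCoupled

end
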